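import Summits.KontsevichZagierPeriods.KontsevichZagierPeriods.Theorems.SectorTwoSix.Negative.LoadBearing

/-!
# `SectorTwoSix` (stmt-KontsevichZagierPeriods-3870) — negative side, II: the SCISSORS sub-calculus
# (rules 1a + 2) cannot prove the crux; integrand additivity (rule 1b) is load-bearing

Refuter (`cdisprove`, cycle 5) by-product for the crux `SectorTwoSix` of route `HurwitzMicroSectors`,
complementing `Negative/LoadBearing.lean` §3 (`not_sectorTwoSixAdditive`: the additivity moves
(1a) + (1b) alone do not prove the crux; a change of variables or a Newton–Leibniz move is needed).
Here the DUAL statement: the sub-calculus generated by domain additivity (1a) and change of variables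
(2) — cut the domain and transport the pieces by `ℚ`-semialgebraic diffeomorphisms — does not prove it
either, so ANY proof uses integrand additivity (1b) or Newton–Leibniz (3); a Newton–Leibniz-free proof
must therefore use BOTH (1b) and (2) (the candidate proof in the crux work file uses exactly these).

* §1 a new additive invariant, the POSITIVE-PART MASS `posMass [σ, f] = ∫_σ max (f x) 0`: it kills
  (1a) (`f = fᵢ` on `σᵢ` ⇒ `f⁺ = fᵢ⁺`, and `∫_{σ₁∪σ₂} = ∫_{σ₁} + ∫_{σ₂}` for `σ₁ ∩ σ₂` null) and (2)
  (`f = (f'∘Φ)|det Φ'|` ⇒ `f⁺ = (f'⁺∘Φ)|det Φ'|` since `|det Φ'| ≥ 0`, then Mathlib's Jacobian formula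
  `integral_image_eq_integral_abs_det_fderiv_smul` for `f'⁺`): `closure_scissors_le_ker_posMass`.
  It is NOT an invariant of (1b): `posMass_integrandAdd_witness` (`[box,0] − [box,1] − [box,−1]`, mass `−1`).
* §2 the witness inside the crux: the ZERO-VALUED numerator `P₀ = (1 + t³) − 4t` (`H₀ + H₃ = 4H₁`,
  `value_pair_eq`) against `P = 0`; on the corner `(0,¼)²` its integrand is `≥ ½`, so
  `posMass [P₀] ≥ 1/32 > 0 = posMass [0]` and `[box, P₀/(1−t⁶)] − [box, 0] ∉ closure (domainAddRel ∪
  changeOfVariablesRel)` (`P0_not_mem_closure_scissors`); in particular the two are not ONE change of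
  variables apart in either orientation (`P0_pair_not_mem_changeOfVariablesRel`), in contrast with the
  positive pair `[1+t³]`, `[4t]` of `LoadBearing.pair_mem_changeOfVariablesRel`.
* §3 the sub-calculus statement `SectorTwoSixScissors` (the crux with `KZ.relations` replaced by
  `closure (domainAddRel ∪ changeOfVariablesRel)`, CDT antecedent dropped) is FALSE
  (`not_sectorTwoSixScissors`); keeping the CDT antecedent makes it equivalent to `¬ CDT`
  (`scissors_imp_iff_not_cdt`).

Sources: M. Kontsevich, D. Zagier, *Periods* (2001), §1.2 (the rules); the invariant is elementary
measure theory (Mathlib `MeasureTheory.integral_image_eq_integral_abs_det_fderiv_smul`).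
-/

noncomputable section

open MeasureTheory Set Polynomial
open Literature.NumberTheory.Transcendental Literature.ModelTheory.ExponentialFields

namespace Summit.KontsevichZagierPeriods.Theorems.SectorTwoSix.Negative

/-! ## §1 The positive-part mass: an invariant of rules (1a) + (2) -/

/-- The positive-part mass `[σ, f] ↦ ∫_σ max (f x) 0`, extended additively to `KZ.FormalRep`.
[folklore] -/
def posMass : KZ.FormalRep →+ ℝ :=
  FreeAbelianGroup.lift fun p => ∫ x in p.2.domain, max (p.2.integrand x) 0

/-- `posMass` of a generator. [folklore] -/
@[simp] theorem posMass_of {n : ℕ} (r : KZ.IntegralRep n) :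
    posMass (KZ.of r) = ∫ x in r.domain, max (r.integrand x) 0 :=
  FreeAbelianGroup.lift_apply_of _ _

/-- Domain additivity (rule 1a) preserves the positive-part mass: the localisation to `f⁺` of the
soundness computation `∫_{σ₁ ∪ σ₂} = ∫_{σ₁} + ∫_{σ₂}` (`σ₁ ∩ σ₂` null).
[cite: KontsevichZagier2001, §1.2 rule (1)] -/
theorem posMass_eq_zero_of_mem_domainAddRel {c : KZ.FormalRep} (hc : c ∈ KZ.domainAddRel) :
    posMass c = 0 := by
  obtain ⟨n, r, r₁, r₂, hdom, hnull, h₁, h₂, rfl⟩ := hc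
  have hm₁ : MeasurableSet r₁.domain := KZ.IntegralRep.measurableSet_domain_holds r₁
  have hm₂ : MeasurableSet r₂.domain := KZ.IntegralRep.measurableSet_domain_holds r₂
  have hae : AEDisjoint volume r₁.domain r₂.domain := hnull
  have hi : IntegrableOn (fun x => max (r.integrand x) 0) (r₁.domain ∪ r₂.domain) := by
    have h := r.integrableOn
    rw [hdom] at h
    exact h.pos_part
  simp only [map_sub, posMass_of]
  rw [sub_sub, sub_eq_zero, hdom, setIntegral_union₀ hae hm₂.nullMeasurableSet hi.left_of_union
      hi.right_of_union,
    setIntegral_congr_fun hm₁ (fun x hx => by rw [h₁ hx]),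
    setIntegral_congr_fun hm₂ (fun x hx => by rw [h₂ hx])]

/-- Change of variables (rule 2) preserves the positive-part mass: `|det Φ'| ≥ 0` commutes with
`max · 0`, then Mathlib's Jacobian formula for the integrand `f'⁺`.
[cite: KontsevichZagier2001, §1.2 rule (2)] -/
theorem posMass_eq_zero_of_mem_changeOfVariablesRel {c : KZ.FormalRep}
    (hc : c ∈ KZ.changeOfVariablesRel) : posMass c = 0 := by
  obtain ⟨n, r, r', Φ, Φ', -, hΦ', hinj, hdom, hf, rfl⟩ := hc
  have hm : MeasurableSet r.domain := KZ.IntegralRep.measurableSet_domain_holds r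
  simp only [map_sub, posMass_of, sub_eq_zero]
  rw [hdom, integral_image_eq_integral_abs_det_fderiv_smul volume hm hΦ' hinj
      (fun y => max (r'.integrand y) 0)]
  refine setIntegral_congr_fun hm fun x hx => ?_
  rw [hf x hx, smul_eq_mul, mul_max_of_nonneg _ _ (abs_nonneg _), mul_zero, mul_comm]

/-- **The scissors sub-calculus (rules 1a + 2) lies in the kernel of `posMass`.** Since integrand
additivity and Newton–Leibniz moves do not preserve it, a combination with non-zero positive-part
mass needs a move of type (1b) or (3). [cite: KontsevichZagier2001, §1.2] -/
theorem closure_scissors_le_ker_posMass :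
    AddSubgroup.closure (KZ.domainAddRel ∪ KZ.changeOfVariablesRel) ≤ posMass.ker := by
  refine (AddSubgroup.closure_le _).mpr ?_
  rintro c (hc | hc)
  · exact posMass_eq_zero_of_mem_domainAddRel hc
  · exact posMass_eq_zero_of_mem_changeOfVariablesRel hc

/-- `[box, (a(1−t⁶))/(1−t⁶)] = [box, a]` has positive-part mass `max a 0` (the box has volume `1`).
[folklore] -/
theorem posMass_sectorRep_C_mul (a : ℚ) :
    posMass (KZ.of (sectorRep (C a * (1 - X ^ 6)))) = max (a : ℝ) 0 := by
  rw [posMass_of, sectorRep_domain, sectorRep_integrand]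
  have h1 : ∫ x in box, max (sectorFun (C a * (1 - X ^ 6)) x) 0 = ∫ _ in box, max (a : ℝ) 0 := by
    refine setIntegral_congr_fun (BoxIntegral.measurableSet_box 2) fun x hx => ?_
    have h := (den_pos hx).ne'
    simp only [sectorFun, map_mul, Polynomial.aeval_C, map_sub, map_one, map_pow, Polynomial.aeval_X,
      eq_ratCast]
    rw [mul_div_assoc, div_self h, mul_one]
  rw [h1]
  exact BoxIntegral.setIntegral_box_const 2 _

/-- Integrand additivity (rule 1b) does NOT preserve `posMass`: `[box, 0] − [box, 1] − [box, −1]`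
(numerators `0`, `1 − t⁶`, `−(1 − t⁶)`) is a rule-(1b) instance of positive-part mass
`0 − 1 − 0 = −1`. [cite: KontsevichZagier2001, §1.2 rule (1)] -/
theorem posMass_integrandAdd_witness :
    KZ.of (sectorRep (C 0 * (1 - X ^ 6))) - KZ.of (sectorRep (C 1 * (1 - X ^ 6))) -
        KZ.of (sectorRep (C (-1) * (1 - X ^ 6))) ∈ KZ.integrandAddRel ∧
      posMass (KZ.of (sectorRep (C 0 * (1 - X ^ 6))) - KZ.of (sectorRep (C 1 * (1 - X ^ 6))) -
        KZ.of (sectorRep (C (-1) * (1 - X ^ 6)))) = -1 := by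
  refine ⟨⟨2, sectorRep (C 0 * (1 - X ^ 6)), sectorRep (C 1 * (1 - X ^ 6)),
    sectorRep (C (-1) * (1 - X ^ 6)), rfl, rfl, fun x _ => ?_, rfl⟩, ?_⟩
  · simp only [sectorRep_integrand, Pi.add_apply, sectorFun, map_mul, Polynomial.aeval_C, eq_ratCast,
      map_sub, map_one, map_pow, Polynomial.aeval_X, Rat.cast_zero, Rat.cast_one, Rat.cast_neg]
    ring
  · simp only [map_sub, posMass_sectorRep_C_mul, Rat.cast_zero, Rat.cast_one, Rat.cast_neg, max_self]
    rw [max_eq_left (zero_le_one' ℝ), max_eq_right (by norm_num : (-1:ℝ) ≤ 0)]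
    norm_num

/-! ## §2 The zero-valued numerator `P₀ = (1 + t³) − 4t` has positive positive-part mass -/

/-- Values are subtractive in the numerator. [folklore] -/
theorem value_sectorRep_sub (P Q : ℚ[X]) :
    (sectorRep (P - Q)).value = (sectorRep P).value - (sectorRep Q).value := by
  have h := value_sectorRep_add (P - Q) Q
  rw [sub_add_cancel] at h
  linarith

/-- `[box, ((1+t³) − 4t)/(1−t⁶)]` has value `0` (`H₀ + H₃ = 4H₁`, `value_pair_eq`). [folklore] -/
theorem value_sectorRep_P0 : (sectorRep ((1 + X ^ 3) - 4 * X)).value = 0 := by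
  rw [value_sectorRep_sub, value_pair_eq, sub_self]

/-- `[box, 0]` has positive-part mass `0`. [folklore] -/
theorem posMass_sectorRep_zero : posMass (KZ.of (sectorRep (0 : ℚ[X]))) = 0 := by
  rw [posMass_of]
  simp [sectorFun]

/-- On the corner `(0,¼)²` the integrand of `[P₀]` is `≥ ½` (`t < 1/16`: `1 − 4t + t³ ≥ ¾`,
`0 < 1 − t⁶ ≤ 1`). [folklore] -/
theorem sectorFun_P0_ge {x : Fin 2 → ℝ} (hx : x ∈ Set.pi univ fun _ => Ioo (0:ℝ) 4⁻¹) :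
    2⁻¹ ≤ sectorFun ((1 + X ^ 3) - 4 * X) x := by
  obtain ⟨ht0, ht16⟩ := prod_bounds_of_mem_corner hx
  have hxb : x ∈ box := by
    rw [mem_univ_pi] at hx
    exact fun i => ⟨(hx i).1, (hx i).2.trans (by norm_num)⟩
  have hb : 0 < 1 - (x 0 * x 1) ^ 6 := den_pos hxb
  have h3 : 0 ≤ (x 0 * x 1) ^ 3 := pow_nonneg ht0.le 3
  have h6 : 0 ≤ (x 0 * x 1) ^ 6 := pow_nonneg ht0.le 6
  simp only [sectorFun, map_sub, map_add, map_one, map_pow, map_mul, map_ofNat, Polynomial.aeval_X]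
  rw [le_div_iff₀ hb]
  nlinarith

/-- **`[P₀]` has positive-part mass `≥ 1/32 > 0`.** [folklore] -/
theorem posMass_sectorRep_P0_pos : 0 < posMass (KZ.of (sectorRep ((1 + X ^ 3) - 4 * X))) := by
  rw [posMass_of, sectorRep_domain, sectorRep_integrand]
  set C : Set (Fin 2 → ℝ) := Set.pi univ fun _ => Ioo (0:ℝ) 4⁻¹ with hC
  have hCm : MeasurableSet C := MeasurableSet.univ_pi fun _ => measurableSet_Ioo
  have hCsub : C ⊆ box := by
    intro x hx
    rw [hC, mem_univ_pi] at hx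
    exact fun i => ⟨(hx i).1, (hx i).2.trans (by norm_num)⟩
  have hvol : volume C = ENNReal.ofReal 16⁻¹ := by
    rw [hC, volume_pi_pi]
    simp only [Real.volume_Ioo, Finset.prod_const, Finset.card_univ, Fintype.card_fin, sub_zero]
    rw [← ENNReal.ofReal_pow (by norm_num)]
    norm_num
  have hvolr : volume.real C = 16⁻¹ := by
    simp [Measure.real, hvol]
  have hint : IntegrableOn (fun x => max (sectorFun ((1 + X ^ 3) - 4 * X) x) 0) box volume :=
    (integrableOn_sectorFun _).pos_part
  have hle1 : ∫ x in C, max (sectorFun ((1 + X ^ 3) - 4 * X) x) 0 ≤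
      ∫ x in box, max (sectorFun ((1 + X ^ 3) - 4 * X) x) 0 :=
    setIntegral_mono_set hint (ae_of_all _ fun x => le_max_right _ _)
      (Filter.Eventually.of_forall hCsub)
  have hconst : IntegrableOn (fun _ : Fin 2 → ℝ => (2⁻¹ : ℝ)) C := by
    refine integrableOn_const ?_
    rw [hvol]; exact ENNReal.ofReal_ne_top
  have hle2 : ∫ _ in C, (2⁻¹ : ℝ) ≤ ∫ x in C, max (sectorFun ((1 + X ^ 3) - 4 * X) x) 0 := by
    refine setIntegral_mono_on hconst (hint.mono_set hCsub) hCm fun x hx => ?_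
    exact (sectorFun_P0_ge hx).trans (le_max_left _ _)
  have hcv : ∫ _ in C, (2⁻¹ : ℝ) = 32⁻¹ := by
    rw [setIntegral_const, hvolr]
    norm_num
  have : (0:ℝ) < 32⁻¹ := by norm_num
  linarith

/-- **The scissors sub-calculus does not reach the zero-valued numerator**:
`[box, P₀/(1−t⁶)] − [box, 0] ∉ closure (domainAddRel ∪ changeOfVariablesRel)`. [folklore] -/
theorem P0_not_mem_closure_scissors :
    KZ.of (sectorRep ((1 + X ^ 3) - 4 * X)) - KZ.of (sectorRep 0) ∉
      AddSubgroup.closure (KZ.domainAddRel ∪ KZ.changeOfVariablesRel) := by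
  intro hmem
  have h0 := closure_scissors_le_ker_posMass hmem
  rw [AddMonoidHom.mem_ker, map_sub, posMass_sectorRep_zero, sub_zero] at h0
  exact posMass_sectorRep_P0_pos.ne' h0

/-- In particular `[P₀]` and `[0]` are not ONE change of variables apart, in either orientation
(compare `pair_mem_changeOfVariablesRel`: the POSITIVE pair `[1+t³]`, `[4t]` is one dilation apart).
[folklore] -/
theorem P0_pair_not_mem_changeOfVariablesRel :
    KZ.of (sectorRep ((1 + X ^ 3) - 4 * X)) - KZ.of (sectorRep 0) ∉ KZ.changeOfVariablesRel ∧
      KZ.of (sectorRep 0) - KZ.of (sectorRep ((1 + X ^ 3) - 4 * X)) ∉ KZ.changeOfVariablesRel := by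
  refine ⟨fun h => P0_not_mem_closure_scissors (AddSubgroup.subset_closure (Or.inr h)), fun h => ?_⟩
  have := (AddSubgroup.closure (KZ.domainAddRel ∪ KZ.changeOfVariablesRel)).neg_mem
    (AddSubgroup.subset_closure (Or.inr h))
  rw [neg_sub] at this
  exact P0_not_mem_closure_scissors this

/-! ## §3 The sub-calculus statement and its refutation -/

/-- Strengthening IV (a SUB-CALCULUS): the crux with `KZ.relations` replaced by the subgroup
generated by domain additivity (rule 1a) and change of variables (rule 2) — the "scissors"
sub-calculus — the CDT antecedent dropped; refuted below (a statement variant of this file, not a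
literature fact). -/
def SectorTwoSixScissors : Prop :=
  ∀ (r r' : KZ.IntegralRep 2) (P P' : ℚ[X]), r.domain = {x | ∀ i, x i ∈ Set.Ioo (0:ℝ) 1} →
    r'.domain = {x | ∀ i, x i ∈ Set.Ioo (0:ℝ) 1} →
    EqOn r.integrand (fun x => Polynomial.aeval (x 0 * x 1) P / (1 - (x 0 * x 1) ^ 6)) r.domain →
    EqOn r'.integrand (fun x => Polynomial.aeval (x 0 * x 1) P' / (1 - (x 0 * x 1) ^ 6)) r'.domain →
    r.value = r'.value →
      KZ.of r - KZ.of r' ∈ AddSubgroup.closure (KZ.domainAddRel ∪ KZ.changeOfVariablesRel)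

/-- **Rules (1a) + (2) are not enough**: a zero-valued representation of the sector lies outside the
scissors sub-calculus's reach of `[box, 0]`, so ANY proof of `SectorTwoSix` uses integrand additivity
(rule 1b) or a Newton–Leibniz move (rule 3). With `not_sectorTwoSixAdditive`: a Newton–Leibniz-free
proof uses both (1b) and (2). [folklore] -/
theorem not_sectorTwoSixScissors : ¬ SectorTwoSixScissors := fun h =>
  P0_not_mem_closure_scissors (h (sectorRep ((1 + X ^ 3) - 4 * X)) (sectorRep 0) _ _ rfl rfl
    (sectorRep_eqOn _) (sectorRep_eqOn _) (by rw [value_sectorRep_P0, value_sectorRep_zero]))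

/-- Keeping the CDT antecedent does not rescue the scissors sub-crux: `CDT → SectorTwoSixScissors` is
equivalent to `¬ CDT`. [folklore] -/
theorem scissors_imp_iff_not_cdt :
    ((LinearIndependent ℚ ![(1 : ℝ), Real.pi ^ 2,
        (∑' n : ℕ, (1 / (3 * (n : ℝ) + 1) ^ 2 - 1 / (3 * (n : ℝ) + 2) ^ 2))]) →
      SectorTwoSixScissors) ↔
    ¬ LinearIndependent ℚ ![(1 : ℝ), Real.pi ^ 2,
        (∑' n : ℕ, (1 / (3 * (n : ℝ) + 1) ^ 2 - 1 / (3 * (n : ℝ) + 2) ^ 2))] :=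
  ⟨fun h hc => not_sectorTwoSixScissors (h hc), fun h hc => absurd hc h⟩

/-- `posMass` is blind to the POSITIVE pair of `LoadBearing` §0/§4: for a numerator whose integrand is
`≥ 0` on the box the positive-part mass is the value, so `[1+t³]` and `[4t]` have equal `posMass`
(and indeed they are one dilation apart). The obstruction to scissors lives in the SIGN CHANGES of
zero-valued integrands. [folklore] -/
theorem posMass_eq_value_of_nonneg (P : ℚ[X]) (hP : ∀ x ∈ box, 0 ≤ sectorFun P x) :
    posMass (KZ.of (sectorRep P)) = (sectorRep P).value := by
  rw [posMass_of, KZ.IntegralRep.value, sectorRep_domain, sectorRep_integrand]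
  exact setIntegral_congr_fun (BoxIntegral.measurableSet_box 2) fun x hx => max_eq_left (hP x hx)

end Summit.KontsevichZagierPeriods.Theorems.SectorTwoSix.Negative
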